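import Mathlib.Analysis.InnerProductSpace.PiL2
import Literature.Geometry.DiscreteGeometry.CountingSpheres
import HarnessLib

/-!
# The kissing number in dimension three is twelve (Schütte–van der Waerden 1953; Musin 2006)

Topic `Literature/Geometry/DiscreteGeometry`; ONE named fact (a theorem in print, `def … : Prop`,
D-0014), filed by a grounder for route `AtomisticToContinuum/SquareWellJamming`, whose crux
`Summit.AtomisticToContinuum.Crystallization.Theses.SquareWellJamming.KissingNumberTwelve`
(item `stmt-AtomisticToContinuum-3617`) it grounds VERBATIM, plus the proved bridge from the
tree's (unproved) Flyspeck inequality `flyspeck_L12`.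

* **Musin 2006** (Discrete Comput. Geom. 35, 375–384 = arXiv:math/0410324, read p. 4):
  "If `n` unit spheres kiss the unit sphere in `ℝ³`, then the set of kissing points is an
  arrangement on the central sphere such that the (Euclidean) distance between any two points is
  at least `1`. […] **Theorem.** `k(3) = 12`."  The first proof is Schütte–van der Waerden 1953
  (Math. Ann. 125, "Das Problem der dreizehn Kugeln"); further proofs: Leech 1956, Maehara 2007
  (elementary), Anstreicher 2004, Bachoc–Vallentin 2008 (SDP), and Hales 2012 §1 via the Flyspeck
  inequality `L12` (in tree: `card_le_twelve_of_flyspeck_L12`, radius-`2` normalisation).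
  Vendored as the upper bound in the chordal form printed by Musin: every finite set of unit
  vectors of `ℝ³` with pairwise Euclidean distances `≥ 1` has at most `12` elements —
  `musin2006_kissing_three`. (The lower bound `k(3) ≥ 12` is the cuboctahedron/icosahedron
  computation, left to consumers.)

## Rendering

* `ℝ³ = EuclideanSpace ℝ (Fin 3)`; configurations are `Finset`s of unit vectors; "non-overlapping
  unit balls touching the central unit ball" = contact points at pairwise distance `≥ 1`
  (angular separation `≥ 60°`), exactly as in Musin's reformulation.
* Proved: `musin2006_kissing_three_of_flyspeck_L12` — the fact follows from `flyspeck_L12` by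
  rescaling by `2` and `card_le_twelve_of_flyspeck_L12` (Hales 2012, §1 and Lemma 1).

## References

* O. R. Musin, *The kissing problem in three dimensions*, Discrete Comput. Geom. 35 (2006)
  375–384, arXiv:math/0410324: p. 4, Theorem (`k(3) = 12`) and the preceding paragraph.
  [`Musin2005`]
* K. Schütte, B. L. van der Waerden, *Das Problem der dreizehn Kugeln*, Math. Ann. 125 (1953)
  325–334. [`SchutteVanderwaerden1952`]
* H. Maehara, *The problem of thirteen spheres — a proof for undergraduates*, European J. Combin.
  28 (2007) 1770–1778. [`Maehara2007`]
* T. C. Hales, *A proof of Fejes Tóth's conjecture on sphere packings with kissing number twelve*,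
  arXiv:1209.6043 (2012): §1 and Lemma 1 (`L12`). [`Hales2012`]
-/

noncomputable section

namespace Literature.Geometry.DiscreteGeometry

open Finset

/-- **The kissing number in three dimensions is (at most) twelve** (Schütte–van der Waerden 1953;
Musin 2006, Theorem `k(3) = 12`, in Musin's chordal reformulation: "the set of kissing points is
an arrangement on the central sphere such that the (Euclidean) distance between any two points is
at least 1"): every finite set of unit vectors of `ℝ³` with pairwise distances `≥ 1` has at most
twelve elements. Grounds `Summit.AtomisticToContinuum.Crystallization.Theses.SquareWellJamming.KissingNumberTwelve`
(item `stmt-AtomisticToContinuum-3617`) verbatim.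
[cite: Musin2005, p. 4 Theorem (k(3) = 12)] [cite: SchutteVanderwaerden1952, Satz (r₁₃ > 1)] -/
def musin2006_kissing_three : Prop :=
  ∀ T : Finset (EuclideanSpace ℝ (Fin 3)), (∀ v ∈ T, ‖v‖ = 1) →
    (∀ v ∈ T, ∀ w ∈ T, v ≠ w → 1 ≤ dist v w) → T.card ≤ 12

/-- **The kissing bound from Flyspeck's `L12`.** `musin2006_kissing_three` follows from the
(unproved, named) inequality `flyspeck_L12` of the tree: rescale the configuration by `2` and apply
`card_le_twelve_of_flyspeck_L12` (Hales 2012, §1: "It is known that the kissing number in three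
dimensions is twelve"; a one-line consequence of Lemma 1). [cite: Hales2012, §1 and Lemma 1] -/
theorem musin2006_kissing_three_of_flyspeck_L12 (hL12 : flyspeck_L12) :
    musin2006_kissing_three := by
  intro T hnorm hdist
  classical
  have hinj : Set.InjOn (fun v : EuclideanSpace ℝ (Fin 3) => (2 : ℝ) • v) (T : Set _) := by
    intro v _ w _ h
    exact smul_right_injective _ (by norm_num : (2 : ℝ) ≠ 0) h
  have hcard : (T.image fun v => (2 : ℝ) • v).card = T.card := Finset.card_image_of_injOn hinj
  rw [← hcard]
  refine card_le_twelve_of_flyspeck_L12 hL12 _ ?_ ?_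
  · intro v hv w hw hvw
    obtain ⟨v', hv', rfl⟩ := Finset.mem_image.1 hv
    obtain ⟨w', hw', rfl⟩ := Finset.mem_image.1 hw
    have hne : v' ≠ w' := fun h => hvw (by rw [h])
    have h1 := hdist v' hv' w' hw' hne
    rw [dist_smul₀, Real.norm_two]
    linarith
  · intro v hv
    obtain ⟨v', hv', rfl⟩ := Finset.mem_image.1 hv
    rw [norm_smul, Real.norm_two, hnorm v' hv']
    norm_num

end Literature.Geometry.DiscreteGeometry
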